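import Literature.AlgebraicGeometry.Resolution.RationalFunctionsToProjectiveSpace
import Literature.AlgebraicGeometry.Motives.CartierDivisorExtension
import HarnessLib

/-!
# Two criteria for rational maps: regularity from local sections, dominance from a chart

Topic `Literature/AlgebraicGeometry/Resolution`; theorem-only helpers for the extension of a
rational map to a blow-up (Shioda–Katsura, Tôhoku Math. J. 31 (1979), Thm. 1.7 (i)).

* `mem_lsChart_of_eq_mul_ofSection` — the rational map `(z₀ : … : zₙ)` of a vector of rational
  functions on an integral scheme is defined at `x` (in the chart `c₀`) as soon as, near `x`,
  `z_c = μ · [τ_c]` for sections `τ_c` with a common factor `μ ≠ 0` and `τ_{c₀}(x) ≠ 0`;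
* `apply_genericPoint_eq_genericPoint_of_injective` — a morphism `f : X → Y` of integral schemes
  is dominant as soon as `f^* : Γ(Y, V) → Γ(X, U)` is injective for one affine open `V` and one
  non-empty open `U ⊆ f⁻¹V`;
* `surjective_of_isClosedMap_of_apply_genericPoint_eq` — a closed dominant morphism is onto.

## References

* R. Hartshorne, *Algebraic Geometry* (1977), II Thm. 7.1 (proof), II Ex. 3.7. [Hartshorne1977]
-/

noncomputable section

universe u

open CategoryTheory AlgebraicGeometry TopologicalSpace

namespace Literature.AlgebraicGeometry.Resolution

open Literature.AlgebraicGeometry.Motives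

/-! ## Regularity from local sections -/

/-- **The rational map `(z₀ : … : zₙ)` is defined at `x`, in the chart `c₀`**, if on an open
`V ∋ x` there are sections `τ_c` and a rational function `μ ≠ 0` with `z_c = μ · [τ_c]` for all `c`
and `τ_{c₀}` invertible at `x`: then `z_{c₀} ≠ 0` and `z_c/z_{c₀} = [τ_c] · [τ_{c₀}]⁻¹` is regular at
`x`. [cite: Hartshorne1977, II Thm. 7.1 (proof)] -/
theorem mem_lsChart_of_eq_mul_ofSection {X : Scheme.{u}} [IsIntegral X] {n : ℕ}
    (z : Fin (n + 1) → X.functionField) {V : X.Opens} {x : X} (hx : x ∈ V)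
    (τ : Fin (n + 1) → Γ(X, V)) (μ : X.functionField) (hμ : μ ≠ 0)
    (hz : ∀ c, z c = μ * RatFn.ofSection (RatFn.genericPoint_mem_of_mem hx) (τ c)) {c₀ : Fin (n + 1)}
    (hc₀ : x ∈ X.basicOpen (τ c₀)) : x ∈ lsChart z c₀ := by
  have hunit : RatFn.IsUnitAt x (RatFn.ofSection (RatFn.genericPoint_mem_of_mem hx) (τ c₀)) :=
    (RatFn.isUnitAt_ofSection_iff hx (τ c₀)).mpr hc₀
  have h0 : z c₀ ≠ 0 := by
    rw [hz c₀]
    exact mul_ne_zero hμ hunit.ne_zero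
  refine (mem_lsChart_iff z).mpr ⟨h0, fun l ↦ ?_⟩
  have hdiv : z l / z c₀ = RatFn.ofSection (RatFn.genericPoint_mem_of_mem hx) (τ l) *
      (RatFn.ofSection (RatFn.genericPoint_mem_of_mem hx) (τ c₀))⁻¹ := by
    rw [hz l, hz c₀, mul_div_mul_left _ _ hμ, div_eq_mul_inv]
  rw [hdiv]
  exact (RatFn.isRegularAt_ofSection hx (τ l)).mul hunit.inv.isRegularAt

/-! ## Dominance from one chart -/

/-- **Dominance from the injectivity of `f^*` on one chart.** For integral `X`, `Y`, an affine
open `V ⊆ Y` and a non-empty open `U ⊆ f⁻¹V` with `f^* : Γ(Y, V) → Γ(X, U)` injective, `f` maps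
the generic point of `X` to the generic point of `Y`: a function `a ∈ Γ(Y, V)` vanishing at
`f(ξ_X)` has `f^*a` vanishing at `ξ_X`, hence on all of `U`, so `f^*a = 0` (`X` reduced) and
`a = 0`; thus the prime of `f(ξ_X)` in `Γ(Y, V)` is `0`, the generic point.
[cite: Hartshorne1977, II Ex. 3.7] -/
theorem apply_genericPoint_eq_genericPoint_of_injective {X Y : Scheme.{u}} [IsIntegral X]
    [IsIntegral Y] (f : X ⟶ Y) {V : Y.Opens} (hV : IsAffineOpen V) {U : X.Opens}
    (hUV : U ≤ f ⁻¹ᵁ V) (hU : (U : Set X).Nonempty)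
    (hinj : Function.Injective (f.appLE V U hUV)) : f (genericPoint X) = genericPoint Y := by
  have hξU : genericPoint X ∈ U :=
    ((genericPoint_spec X).mem_open_set_iff U.2).mpr (by rwa [Set.univ_inter])
  have hηV : f (genericPoint X) ∈ V := hUV hξU
  -- the prime of `η = f ξ` in `Γ(Y, V)` is `⊥`
  set 𝔭 := hV.primeIdealOf ⟨f (genericPoint X), hηV⟩ with h𝔭
  have hbot : 𝔭.asIdeal = ⊥ := by
    refine (Submodule.eq_bot_iff _).mpr fun a ha ↦ ?_
    -- `η ∉ Y_a`
    have hηa : f (genericPoint X) ∉ Y.basicOpen a := by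
      intro hmem
      have h1 : hV.fromSpec 𝔭 ∈ Y.basicOpen a := by
        rw [h𝔭, hV.fromSpec_primeIdealOf]
        exact hmem
      have h2 : 𝔭 ∈ hV.fromSpec ⁻¹ᵁ Y.basicOpen a := h1
      rw [hV.fromSpec_preimage_basicOpen] at h2
      exact h2 ha
    -- so `ξ ∉ X_{f^* a}`, hence `f^* a = 0`
    have hξa : genericPoint X ∉ X.basicOpen (f.appLE V U hUV a) := by
      rw [Scheme.basicOpen_appLE]
      exact fun h ↦ hηa h.2
    have hempty : X.basicOpen (f.appLE V U hUV a) = ⊥ := by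
      by_contra hne
      have hne' : ((X.basicOpen (f.appLE V U hUV a) : X.Opens) : Set X).Nonempty := by
        rw [Set.nonempty_iff_ne_empty]
        exact fun h ↦ hne (Opens.ext h)
      exact hξa (((genericPoint_spec X).mem_open_set_iff (X.basicOpen _).2).mpr
        (by rwa [Set.univ_inter]))
    rw [basicOpen_eq_bot_iff] at hempty
    exact hinj (hempty.trans (map_zero _).symm)
  -- hence `η` is the generic point
  haveI : Nonempty V := ⟨⟨_, hηV⟩⟩
  have h1 : hV.fromSpec 𝔭 = f (genericPoint X) := hV.fromSpec_primeIdealOf ⟨_, hηV⟩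
  rw [← h1]
  have h2 : 𝔭 = genericPoint (Spec Γ(Y, V)) := by
    rw [genericPoint_eq_bot_of_affine]
    exact PrimeSpectrum.ext hbot
  rw [h2]
  exact genericPoint_eq_of_isOpenImmersion hV.fromSpec

/-- **A closed dominant morphism is surjective.** [folklore] -/
theorem surjective_of_isClosedMap_of_apply_genericPoint_eq {X Y : Scheme.{u}} [IsIntegral X]
    [IsIntegral Y] (f : X ⟶ Y) (hc : IsClosedMap f)
    (h : f (genericPoint X) = genericPoint Y) : Function.Surjective f := by
  rw [← Set.range_eq_univ, ← (hc.isClosed_range).closure_eq, ← Set.univ_subset_iff,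
    ← genericPoint_closure Y]
  exact closure_mono (Set.singleton_subset_iff.mpr ⟨_, h⟩)

end Literature.AlgebraicGeometry.Resolution

end
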